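import Literature.Probability.RandomPlanarGeometry.SAWBridgeDiamondPoints
import Literature.Probability.RandomPlanarGeometry.SAWRenewalMeasureSLLN
import Literature.Probability.RandomPlanarGeometry.UniformSAWCurveLaw
import Literature.Probability.RandomPlanarGeometry.SAWBridgeRenewalLimit
import HarnessLib

/-!
# Cone positivity for bridges under a finite mean renewal length (Duminil-Copin–Hammond 2013, §4)

Topic `Literature/Probability/RandomPlanarGeometry` (continues `SAWBridgeDiamondPoints.lean` (cones, cone bridges),
`SAWKestenRenewalMeasure.lean` (Kesten's renewal measure `Q^B = Zd.renewalBridgeMeasure`, the infinite bridge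
`Zd.infBridge`, (8.3.13) `Zd.renewalBridgeMeasure_breakPointCylinder`), `SAWRenewalMeasureSLLN.lean` (the
break-point cylinders `Zd.breakCyl` and the SLLN consequences for `Q^B`), `UniformSAWCurveLaw.lean` (`Zd.revWalk`),
`SAWBridgeRenewalLimit.lean` (the renewal theorem for bridges `Zd.tendsto_bridgeCount_div_pow_of_summable`)).

Source: H. Duminil-Copin, A. Hammond, *Self-avoiding walk is sub-ballistic*, Comm. Math. Phys. 324 (2013)
401–423, arXiv:1205.0401 [DuminilCopinHammond2013], §4, proof of Proposition 4.2 (arXiv v1, p. 21): "An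
irreducible bridge having finite expected size, we deduce that each of `inf_k (x+y)(γ_k)` and `inf_k (y−x)(γ_k)`
is finite `P^{⊗ℕ}_iSAB`-almost surely. For `ℓ ∈ ℕ`, write `ρ_ℓ` for the probability that both of these random
variables is at least `−ℓ`, and choose `K` so that `ρ_K > 0`. We now claim that `ρ_0 ≥ μ_c^{−2K} ρ_K` (4.2).
To verify (4.2), consider an experiment under which the law `P^{⊗ℕ}_iSAB` is constructed by concatenating `2K`
independent samples of `P_iSAB` [which happen to be north-south edges] …"; Lemma 4.1 (3) (pp. 19–20): the reversal
symmetry of the renewal structure.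

This file proves the COUNTING form of cone positivity used by the tree's proof of DCH Theorem 2.5
(`SAWBridgeNoRenewal.lean`), with the almost-sure input ISOLATED AS A HYPOTHESIS (`hcone` below; it is the
SLLN statement `Q^B{∃ t, y(ρ_t) − |x(ρ_t)| < −K} → 0`, proved in `SAWKestenBlockLLN.lean`):
* `Zd.coneGoodBridges d j K` — `j`-step bridges with `y − |x| ≥ −K` throughout;
  `Zd.card_coneGoodBridges_le_card_northConeBridges` — prefixing `K` north steps (the tree's `straightWalk`)
  maps them injectively into `northConeBridges d (K + j)` (the printed (4.2), with `K` for `2K`);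
* `Zd.card_northConeBridges_le_card_southConeBridges_succ` — `#N_j ≤ #S_{j+1}`: append one north step (so the
  top is visited only at the end), reverse time and re-base (`Zd.revWalk`; the printed reflection `σ` of Lemma
  4.1 (3); the plain reversal of a bridge is not a bridge when the top level is revisited, hence the extra step);
* `Zd.renewalBridgeMeasure_biUnion_breakCyl` — the dictionary `Q^B(⋃_{β ∈ S} breakCyl k β) = #S · μ^{−k}` for
  any set `S` of `k`-step bridges ((8.3.13) summed), and `Zd.breakPoint_subset_iUnion_breakCyl`;
* **`Zd.cone_positivity`** — if `Σ_k k λ_k μ^{−k} < ∞` and `hcone`, then `∃ ρ > 0, ∃ k₀, ∀ k ≥ k₀,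
  ρ μ^k ≤ #northConeBridges d k ∧ ρ μ^k ≤ #southConeBridges d k` (`ρ = u/(4μ^{K+1})`, `u = 1/Σ k λ_k μ^{−k}`).
  DEVIATION from print: DCH obtain `δ = P(γ_0 ∈ D_γ) > 0` for the bi-infinite measure and use ergodicity; here
  the same `2K`-step trick is run at the level of counts of finite bridges through the (8.3.13) dictionary and the
  renewal theorem (`b_j μ^{−j} → u > 0` under the finite-mean hypothesis).
-/

noncomputable section

open Finset MeasureTheory Filter Topology Literature.Probability.LatticeModels Literature.Probability.Percolation
open scoped BigOperators ENNReal

namespace Literature.Probability.RandomPlanarGeometry.SAW.Zd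

variable {d : ℕ}

/-! ### The straight north walk and the prefix injection -/

/-- The straight walk `i ↦ (min i n)·e₀` is an `n`-step bridge. [cite: MadrasSlade1993, §1.2] -/
theorem straightWalk_mem_bridges' (n : ℕ) : straightWalk (d + 2) n ∈ bridges (d + 2) n := by
  refine mem_bridges.2 ⟨straightWalk_mem_saws (d + 2) n, fun i h1 h2 => ?_⟩
  simp only [straightWalk, Pi.single_eq_same, min_eq_left h2, min_self, Nat.zero_min, Nat.cast_zero]
  exact ⟨by exact_mod_cast h1, by exact_mod_cast h2⟩

open Classical in
/-- The `j`-step bridges whose sites satisfy `y − |x| ≥ −K` ("`K`-good").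
[cite: DuminilCopinHammond2013, §4, proof of Proposition 4.2 (arXiv v1, p. 21, `ρ_K`)] -/
def coneGoodBridges (d j K : ℕ) : Finset (ℕ → Site (d + 2)) :=
  (bridges (d + 2) j).filter fun β => ∀ t ≤ j, -(K : ℤ) ≤ β t 0 - |β t 1|

open Classical in
/-- Membership in `coneGoodBridges`. [cite: DuminilCopinHammond2013, §4] -/
theorem mem_coneGoodBridges {j K : ℕ} {β : ℕ → Site (d + 2)} :
    β ∈ coneGoodBridges d j K ↔ β ∈ bridges (d + 2) j ∧ ∀ t ≤ j, -(K : ℤ) ≤ β t 0 - |β t 1| :=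
  mem_filter

/-- **Prefixing `K` north steps puts a `K`-good bridge into the north cone**: `#GoodK_j ≤ #N_{K+j}`
(DCH's (4.2) `ρ_0 ≥ μ^{-2K} ρ_K`, counting form). [cite: DuminilCopinHammond2013, §4, eq. (4.2) (arXiv v1, p. 21)] -/
theorem card_coneGoodBridges_le_card_northConeBridges (j K : ℕ) :
    #(coneGoodBridges d j K) ≤ #(northConeBridges d (K + j)) := by
  classical
  refine card_le_card_of_injOn (fun β => concatWalk K (straightWalk (d + 2) K) β) (fun β hβ => ?_)
    (fun β hβ β' hβ' h => ?_)
  · rw [mem_coe, mem_coneGoodBridges] at hβ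
    obtain ⟨hβb, hgood⟩ := hβ
    have hβ0 : β 0 = 0 := (mem_saws.1 (mem_bridges.1 hβb).1).1
    rw [mem_coe, mem_northConeBridges]
    refine ⟨concatWalk_mem_bridges (Nat.le_add_right K j) (straightWalk_mem_bridges' K)
      (by rw [Nat.add_sub_cancel_left]; exact hβb), fun i hi => ?_⟩
    change InNorthCone (concatWalk K (straightWalk (d + 2) K) β i)
    rcases le_or_gt i K with hiK | hiK
    · rw [concatWalk_apply_of_le _ _ hiK]
      simp [InNorthCone, straightWalk, min_eq_left hiK]
    · obtain ⟨t, rfl⟩ : ∃ t, i = K + t := ⟨i - K, by omega⟩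
      rw [concatWalk_apply_add _ _ hβ0]
      have := hgood t (by omega)
      simp only [InNorthCone, straightWalk, min_self, Pi.add_apply, Pi.single_eq_same,
        Pi.single_eq_of_ne (show (1 : Fin (d + 2)) ≠ 0 from by simp), zero_add]
      linarith
  · rw [mem_coe, mem_coneGoodBridges] at hβ hβ'
    exact (concatWalk_injective_pieces (straightWalk_mem_saws (d + 2) K) (mem_bridges.1 hβ.1).1
      (straightWalk_mem_saws (d + 2) K) (mem_bridges.1 hβ'.1).1 h).2

/-! ### Reversal: north-cone bridges of length `j` give south-cone bridges of length `j + 1` -/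

/-- **Reversal injection `#N_j ≤ #S_{j+1}`**: append one north step to a north-cone bridge (so that its top is
visited only at the end), then reverse time and re-base at the new endpoint (the tree's `Zd.revWalk`); the result
is a bridge whose sites lie in the south cone of its endpoint. (The plain reversal of a bridge need not be a
bridge — the top level may be revisited — which is why one step is added first.)
[cite: DuminilCopinHammond2013, §4, Lemma 4.1 (3) and eq. (4.2) (arXiv v1, pp. 19–21)] -/
theorem card_northConeBridges_le_card_southConeBridges_succ (j : ℕ) :
    #(northConeBridges d j) ≤ #(southConeBridges d (j + 1)) := by
  classical
  set f : (ℕ → Site (d + 2)) → ℕ → Site (d + 2) :=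
    fun τ => revWalk (j + 1) (concatWalk j τ (straightWalk (d + 2) 1)) with hf
  have hs1 : straightWalk (d + 2) 1 ∈ bridges (d + 2) (j + 1 - j) := by
    rw [Nat.add_sub_cancel_left]; exact straightWalk_mem_bridges' 1
  have hs0 : straightWalk (d + 2) 1 0 = 0 := (mem_saws.1 (straightWalk_mem_saws (d + 2) 1)).1
  -- values of the extended walk `τ' = τ ∘ e₀`
  have ext_le : ∀ (τ : ℕ → Site (d + 2)) i, i ≤ j → concatWalk j τ (straightWalk (d + 2) 1) i = τ i :=
    fun τ i hi => concatWalk_apply_of_le _ _ hi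
  have ext_top : ∀ τ : ℕ → Site (d + 2),
      concatWalk j τ (straightWalk (d + 2) 1) (j + 1) = τ j + Pi.single 0 1 := by
    intro τ
    rw [concatWalk_apply_add _ _ hs0]
    simp [straightWalk]
  -- values of the reversed walk
  have hfval : ∀ (τ : ℕ → Site (d + 2)) i, τ 0 = 0 →
      f τ i = concatWalk j τ (straightWalk (d + 2) 1) (j + 1) -
        concatWalk j τ (straightWalk (d + 2) 1) (j + 1 - i) := fun τ i _ => rfl
  have hfend : ∀ (τ : ℕ → Site (d + 2)), τ 0 = 0 →
      f τ (j + 1) = concatWalk j τ (straightWalk (d + 2) 1) (j + 1) := by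
    intro τ hτ0
    rw [hfval τ (j + 1) hτ0, Nat.sub_self, ext_le τ 0 (Nat.zero_le _), hτ0, sub_zero]
  refine card_le_card_of_injOn f (fun τ hτ => ?_) (fun τ hτ τ' hτ' h => ?_)
  · rw [mem_coe, mem_northConeBridges] at hτ
    obtain ⟨hτb, hcone⟩ := hτ
    have hτ0 : τ 0 = 0 := (mem_saws.1 (mem_bridges.1 hτb).1).1
    have hext : concatWalk j τ (straightWalk (d + 2) 1) ∈ bridges (d + 2) (j + 1) :=
      concatWalk_mem_bridges (Nat.le_succ j) hτb hs1
    obtain ⟨hexts, -⟩ := mem_bridges.1 hext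
    -- heights of the extended walk below the new top, and nonnegative
    have hlow : ∀ i ≤ j + 1, 1 ≤ i → (concatWalk j τ (straightWalk (d + 2) 1) (j + 1 - i)) 0 ≤ τ j 0 ∧
        0 ≤ (concatWalk j τ (straightWalk (d + 2) 1) (j + 1 - i)) 0 := by
      intro i hi h1
      rw [ext_le τ (j + 1 - i) (by omega)]
      refine ⟨?_, (hcone (j + 1 - i) (by omega)).nonneg⟩
      rcases Nat.eq_zero_or_pos (j + 1 - i) with h0 | hpos
      · rw [h0, hτ0]
        exact (hcone j le_rfl).nonneg
      · exact ((mem_bridges.1 hτb).2 (j + 1 - i) hpos (by omega)).2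
    have htop : (concatWalk j τ (straightWalk (d + 2) 1) (j + 1)) 0 = τ j 0 + 1 := by
      rw [ext_top]; simp
    rw [mem_coe, mem_southConeBridges, mem_bridges]
    refine ⟨⟨revWalk_mem_saws hexts, fun i h1 h2 => ?_⟩, fun i hi => ?_⟩
    · -- bridge property
      have h0' : f τ 0 = 0 := (mem_saws.1 (revWalk_mem_saws hexts)).1
      rw [h0', hfend τ hτ0, hfval τ i hτ0, htop]
      simp only [Pi.sub_apply, Pi.zero_apply]
      have := hlow i h2 h1
      rw [htop]
      constructor <;> linarith [this.1, this.2]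
    · -- south cone at the endpoint
      rw [hfend τ hτ0, hfval τ i hτ0, sub_sub_cancel_left]
      have hpt : InNorthCone (concatWalk j τ (straightWalk (d + 2) 1) (j + 1 - i)) := by
        rcases Nat.eq_zero_or_pos i with rfl | hipos
        · rw [Nat.sub_zero, ext_top]
          have := hcone j le_rfl
          simp only [InNorthCone, Pi.add_apply, Pi.single_eq_same,
            Pi.single_eq_of_ne (show (1 : Fin (d + 2)) ≠ 0 from by simp), add_zero] at this ⊢
          linarith
        · rw [ext_le τ (j + 1 - i) (by omega)]
          exact hcone (j + 1 - i) (by omega)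
      simp only [InSouthCone, InNorthCone, Pi.neg_apply, abs_neg, neg_le_neg_iff] at hpt ⊢
      exact hpt
  · -- injectivity
    rw [mem_coe, mem_northConeBridges] at hτ hτ'
    have hτs := (mem_bridges.1 hτ.1).1
    have hτ's := (mem_bridges.1 hτ'.1).1
    have hτ0 : τ 0 = 0 := (mem_saws.1 hτs).1
    have hτ'0 : τ' 0 = 0 := (mem_saws.1 hτ's).1
    have htop : concatWalk j τ (straightWalk (d + 2) 1) (j + 1) =
        concatWalk j τ' (straightWalk (d + 2) 1) (j + 1) := by
      rw [← hfend τ hτ0, ← hfend τ' hτ'0, h]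
    funext i
    rcases le_or_gt i j with hi | hi
    · have := congrFun h (j + 1 - i)
      rw [hfval τ _ hτ0, hfval τ' _ hτ'0, show j + 1 - (j + 1 - i) = i by omega, htop, sub_right_inj,
        ext_le τ i hi, ext_le τ' i hi] at this
      exact this
    · rw [(mem_saws.1 hτs).2.1 i hi.le, (mem_saws.1 hτ's).2.1 i hi.le]
      have := congrFun h 1
      rw [hfval τ _ hτ0, hfval τ' _ hτ'0, show j + 1 - 1 = j by omega, htop, sub_right_inj,
        ext_le τ j le_rfl, ext_le τ' j le_rfl] at this
      exact this

/-! ### The transfer from Kesten's renewal measure to bridge counts -/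

section Transfer

/-- `Q^B(breakCyl k β) = μ^{-k}` for a `k`-step bridge `β` (a-p6's (8.3.13), restated for the cylinder
`Zd.breakCyl` of `SAWRenewalMeasureSLLN.lean`). [cite: MadrasSlade1993, §8.3, eq. (8.3.13)] -/
theorem renewalBridgeMeasure_breakCyl {k : ℕ} {β : ℕ → Site (d + 2)} (hβ : β ∈ bridges (d + 2) k) :
    renewalBridgeMeasure (d + 2) (breakCyl k β) = ENNReal.ofReal ((connectiveConstant (d + 2) ^ k)⁻¹) :=
  renewalBridgeMeasure_breakPointCylinder hβ

/-- **Counting through `Q^B`**: for a set `S` of `k`-step bridges, `Q^B(⋃_{β ∈ S} breakCyl k β) = #S · μ^{-k}`.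
[cite: MadrasSlade1993, §8.3, eq. (8.3.13) (p. 275, 2013 reprint)] -/
theorem renewalBridgeMeasure_biUnion_breakCyl {k : ℕ} {S : Finset (ℕ → Site (d + 2))}
    (hS : S ⊆ bridges (d + 2) k) :
    renewalBridgeMeasure (d + 2) (⋃ β ∈ S, breakCyl k β) =
      #S * ENNReal.ofReal ((connectiveConstant (d + 2) ^ k)⁻¹) := by
  rw [measure_biUnion_finset (fun β hβ β' hβ' hne => disjoint_breakCyl (hS hβ) (hS hβ') hne)
    (fun β hβ => measurableSet_breakCyl (hS hβ))]
  rw [Finset.sum_congr rfl fun β hβ => renewalBridgeMeasure_breakCyl (hS hβ), sum_const, nsmul_eq_mul]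

/-- The break-point event `A_k` is covered by the break cylinders of all `k`-step bridges.
[cite: MadrasSlade1993, §8.3, Theorem 8.3.2 (p. 275, 2013 reprint)] -/
theorem breakPoint_subset_iUnion_breakCyl (k : ℕ) :
    {φ : ℕ → IrrPiece (d + 2) | ∃ n, piecesLen (takePieces φ n) = k} ⊆ ⋃ β ∈ bridges (d + 2) k, breakCyl k β := by
  intro φ hφ
  obtain ⟨n, hn⟩ := hφ
  have hb := infBridge_head_mem_bridges φ n
  rw [hn] at hb
  rw [Set.mem_iUnion₂]
  refine ⟨_, hb, ⟨n, hn⟩, fun i hi => ?_⟩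
  simp only [min_eq_left hi]

end Transfer

/-! ### Cone positivity -/

/-- **Cone positivity** (the tree's form of DCH's `δ = P(γ_0 ∈ D_γ) > 0`, counting version): if the mean
irreducible-bridge length is finite and `Q^B`-a.s. `inf_t (y(ρ_t) − |x(ρ_t)|) > −∞` (the input `hcone`, an SLLN
consequence proved in `SAWKestenBlockLLN.lean`), then for all large `k` at least `ρ μ^k` of the `k`-step
bridges lie in the north cone of their start and at least `ρ μ^k` in the south cone of their end. Proof:
`#GoodK_j μ^{-j} ≥ Q^B(A_j) − Q^B(not K-good) ≥ u_j − u/4 ≥ u/4` by the transfer and the renewal theorem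
(`u_j = b_j μ^{-j} → u = 1/Σ k λ_k μ^{-k} > 0`), then the prefix and reversal injections.
[cite: DuminilCopinHammond2013, §4, Proposition 4.2, eq. (4.2) and the display `δ := P(γ_0 ∈ D_γ) > 0` before (4.3) (arXiv v1, pp. 20–21)] -/
theorem cone_positivity
    (h : Summable fun k : ℕ => (k : ℝ) * ((irreducibleBridgeCount (d + 2) k : ℝ) / connectiveConstant (d + 2) ^ k))
    (hcone : Tendsto (fun K : ℕ => renewalBridgeMeasure (d + 2)
      {φ | ∃ t : ℕ, (infBridge φ t 0 : ℝ) - |(infBridge φ t 1 : ℝ)| < -(K : ℝ)}) atTop (𝓝 0)) :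
    ∃ ρ : ℝ, 0 < ρ ∧ ∃ k₀ : ℕ, ∀ k ≥ k₀,
      ρ * connectiveConstant (d + 2) ^ k ≤ #(northConeBridges d k) ∧
      ρ * connectiveConstant (d + 2) ^ k ≤ #(southConeBridges d k) := by
  classical
  set μ := connectiveConstant (d + 2) with hμdef
  have hμ : 0 < μ := connectiveConstant_pos _
  have hμ1 : 1 ≤ μ := one_le_connectiveConstant _
  set Q := renewalBridgeMeasure (d + 2) with hQ
  -- the renewal theorem
  have hlim := tendsto_bridgeCount_div_pow_of_summable (d + 2) h
  set m : ℝ := ∑' k : ℕ, (k : ℝ) * ((irreducibleBridgeCount (d + 2) k : ℝ) / μ ^ k) with hm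
  have hm_pos : 0 < m := by
    refine h.tsum_pos (fun k => by positivity) 1 ?_
    have h1 : (1 : ℝ) ≤ irreducibleBridgeCount (d + 2) 1 := by
      exact_mod_cast one_le_irreducibleBridgeCount_one
    have : (0 : ℝ) < (irreducibleBridgeCount (d + 2) 1 : ℝ) / μ ^ 1 := by positivity
    simpa using this
  set u : ℝ := m⁻¹ with hu
  have hu_pos : 0 < u := inv_pos.2 hm_pos
  -- choose `K` with `Q(not K-good) < u/4` and `j₀` with `u_j ≥ u/2` for `j ≥ j₀`
  have eK : ∀ᶠ K : ℕ in atTop, Q {φ | ∃ t : ℕ, (infBridge φ t 0 : ℝ) - |(infBridge φ t 1 : ℝ)| < -(K : ℝ)} <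
      ENNReal.ofReal (u / 4) := hcone.eventually (gt_mem_nhds (by simpa using hu_pos))
  obtain ⟨K, hK⟩ := eK.exists
  have ej : ∀ᶠ j : ℕ in atTop, u / 2 ≤ (bridgeCount (d + 2) j : ℝ) / μ ^ j :=
    hlim.eventually_const_le (by linarith)
  obtain ⟨j₀, hj₀⟩ := eventually_atTop.1 ej
  -- main estimate: `#GoodK_j ≥ (u/4) μ^j` for `j ≥ j₀`
  have hgood : ∀ j ≥ j₀, u / 4 * μ ^ j ≤ #(coneGoodBridges d j K) := by
    intro j hj
    set E : Set (ℕ → IrrPiece (d + 2)) :=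
      {φ | ∃ t : ℕ, (infBridge φ t 0 : ℝ) - |(infBridge φ t 1 : ℝ)| < -(K : ℝ)} with hE
    set A : Set (ℕ → IrrPiece (d + 2)) := {φ | ∃ n, piecesLen (takePieces φ n) = j} with hA
    -- `A ⊆ (⋃_{β good} breakCyl) ∪ E`
    have hcover : A ⊆ (⋃ β ∈ coneGoodBridges d j K, breakCyl j β) ∪ E := by
      intro φ hφ
      obtain ⟨n, hn⟩ := hφ
      have hb := infBridge_head_mem_bridges φ n
      rw [hn] at hb
      by_cases hg : ∀ t ≤ j, -(K : ℤ) ≤ infBridge φ t 0 - |infBridge φ t 1|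
      · left
        rw [Set.mem_iUnion₂]
        refine ⟨_, mem_coneGoodBridges.2 ⟨hb, fun t ht => ?_⟩, ⟨n, hn⟩, fun i hi => ?_⟩
        · simp only [min_eq_left ht]; exact hg t ht
        · simp only [min_eq_left hi]
      · right
        push Not at hg
        obtain ⟨t, -, ht⟩ := hg
        refine ⟨t, ?_⟩
        have : ((infBridge φ t 0 - |infBridge φ t 1| : ℤ) : ℝ) < ((-(K : ℤ) : ℤ) : ℝ) := by exact_mod_cast ht
        push_cast at this
        exact this
    -- measures
    have hAeq : Q A = ENNReal.ofReal ((bridgeCount (d + 2) j : ℝ) / μ ^ j) := by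
      apply le_antisymm
      · calc Q A ≤ Q (⋃ β ∈ bridges (d + 2) j, breakCyl j β) := measure_mono (breakPoint_subset_iUnion_breakCyl j)
          _ = #(bridges (d + 2) j) * ENNReal.ofReal ((μ ^ j)⁻¹) :=
              renewalBridgeMeasure_biUnion_breakCyl subset_rfl
          _ = ENNReal.ofReal ((bridgeCount (d + 2) j : ℝ) / μ ^ j) := by
              rw [bridgeCount, div_eq_mul_inv, ENNReal.ofReal_mul (by positivity), ENNReal.ofReal_natCast]
      · calc ENNReal.ofReal ((bridgeCount (d + 2) j : ℝ) / μ ^ j)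
            = #(bridges (d + 2) j) * ENNReal.ofReal ((μ ^ j)⁻¹) := by
              rw [bridgeCount, div_eq_mul_inv, ENNReal.ofReal_mul (by positivity), ENNReal.ofReal_natCast]
          _ = Q (⋃ β ∈ bridges (d + 2) j, breakCyl j β) := (renewalBridgeMeasure_biUnion_breakCyl subset_rfl).symm
          _ ≤ Q A := measure_mono (Set.iUnion₂_subset fun β _ φ hφ => hφ.1)
    have h1 : Q A ≤ #(coneGoodBridges d j K) * ENNReal.ofReal ((μ ^ j)⁻¹) + ENNReal.ofReal (u / 4) := by
      calc Q A ≤ Q ((⋃ β ∈ coneGoodBridges d j K, breakCyl j β) ∪ E) := measure_mono hcover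
        _ ≤ Q (⋃ β ∈ coneGoodBridges d j K, breakCyl j β) + Q E := measure_union_le _ _
        _ ≤ #(coneGoodBridges d j K) * ENNReal.ofReal ((μ ^ j)⁻¹) + ENNReal.ofReal (u / 4) :=
            add_le_add (renewalBridgeMeasure_biUnion_breakCyl (fun β hβ => (mem_coneGoodBridges.1 hβ).1)).le
              hK.le
    rw [hAeq] at h1
    have h2 : (bridgeCount (d + 2) j : ℝ) / μ ^ j ≤ #(coneGoodBridges d j K) * (μ ^ j)⁻¹ + u / 4 := by
      have := ENNReal.toReal_mono (by finiteness) h1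
      rwa [ENNReal.toReal_ofReal (by positivity), ENNReal.toReal_add (by finiteness) (by finiteness),
        ENNReal.toReal_mul, ENNReal.toReal_natCast, ENNReal.toReal_ofReal (by positivity),
        ENNReal.toReal_ofReal (by positivity)] at this
    have h3 := hj₀ j hj
    have h4 : u / 4 ≤ #(coneGoodBridges d j K) * (μ ^ j)⁻¹ := by linarith
    have := mul_le_mul_of_nonneg_right h4 (pow_pos hμ j).le
    rwa [mul_assoc, inv_mul_cancel₀ (pow_ne_zero j hμ.ne'), mul_one] at this
  -- conclusion with `ρ = u / (4 μ^{K+1})`, `k₀ = K + 1 + j₀`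
  refine ⟨u / (4 * μ ^ (K + 1)), by positivity, K + 1 + j₀, fun k hk => ⟨?_, ?_⟩⟩
  · -- north cone: prefix `K` steps in front of a good bridge of length `k - K`
    have hj : j₀ ≤ k - K := by omega
    have h1 := hgood (k - K) hj
    have h2 := card_coneGoodBridges_le_card_northConeBridges (d := d) (k - K) K
    rw [show K + (k - K) = k by omega] at h2
    have h2' : (#(coneGoodBridges d (k - K) K) : ℝ) ≤ #(northConeBridges d k) := by exact_mod_cast h2
    calc u / (4 * μ ^ (K + 1)) * μ ^ k = u / 4 * μ ^ (k - K) * (μ⁻¹) := by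
          rw [show μ ^ k = μ ^ (k - K) * μ ^ K by rw [← pow_add, Nat.sub_add_cancel (by omega)]]
          field_simp
          ring
      _ ≤ u / 4 * μ ^ (k - K) * 1 := by
          gcongr
          exact inv_le_one_of_one_le₀ hμ1
      _ ≤ #(northConeBridges d k) := by rw [mul_one]; exact h1.trans h2'
  · -- south cone: reverse a north-cone bridge of length `k - 1`
    have hj : j₀ ≤ k - 1 - K := by omega
    have h1 := hgood (k - 1 - K) hj
    have h2 := card_coneGoodBridges_le_card_northConeBridges (d := d) (k - 1 - K) K
    rw [show K + (k - 1 - K) = k - 1 by omega] at h2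
    have h3 := card_northConeBridges_le_card_southConeBridges_succ (d := d) (k - 1)
    rw [show k - 1 + 1 = k by omega] at h3
    have h23 : (#(coneGoodBridges d (k - 1 - K) K) : ℝ) ≤ #(southConeBridges d k) := by exact_mod_cast h2.trans h3
    calc u / (4 * μ ^ (K + 1)) * μ ^ k = u / 4 * μ ^ (k - 1 - K) := by
          rw [show μ ^ k = μ ^ (k - 1 - K) * μ ^ (K + 1) by rw [← pow_add]; congr 1; omega]
          field_simp
      _ ≤ #(southConeBridges d k) := h1.trans h23


end Literature.Probability.RandomPlanarGeometry.SAW.Zd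

end
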